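import Mathlib.Algebra.Homology.HomologicalComplex
import Mathlib.Algebra.Homology.ShortComplex.ModuleCat
import Mathlib.Algebra.Homology.ShortComplex.HomologicalComplex
import Mathlib.Algebra.Category.ModuleCat.Basic
import Mathlib.LinearAlgebra.Matrix.ToLin
import Mathlib.LinearAlgebra.Quotient.Basic
import Mathlib.LinearAlgebra.Dimension.Finrank
import Mathlib.Combinatorics.SimpleGraph.Connectivity.Finite
import Literature.Topology.FourManifolds.KhResolutions
import HarnessLib

-- provenance: harness21/H21/H21/Prelude/FourManL/KhComplex.lean @ 276ee5a (interim HEAD d8f2665); M5 mechanical rewrite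
/-!
# The Khovanov complex of a Gauss diagram (trunk T-4MAN / FourManL, outline C13)

This prelude file of the H21 library (trunk `FourManL`; notion `khovanov_homology_rasmussen_s`,
layer 2 of the tower `KhResolutions → KhComplex → LeeRasmussen`) builds the Khovanov cochain
complex of a Gauss diagram `G : Literature.GaussDiagram` in Viro's *enhanced-state* model, over the
universal rank-two Frobenius system `A = R[X]/(X² - hX - t)` of Khovanov (2006)
(`(h, t) = (0, 0)`: Khovanov's original theory; `(0, 1)`: Lee's theory; `(1, 0)`: Bar-Natan's):

* the multiplication and comultiplication tables `mergeCoeff`, `splitCoeff` of `A` on the basis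
  `{1 ↔ false, X ↔ true}`;
* enhanced states `EnhancedState G` (a state together with a labelling of its circles by
  `1`/`X`, recorded as a function on arcs constant along state circles), their homological
  degree `homDegree` and quantum degree `qDegree`, the Koszul sign `edgeSign`;
* the incidence numbers `incidence R h t s s'` of the differential (Viro (2004), §5.2), the
  degree pieces `degStates i`, `bidegStates i j` and the differential `khovanovD R h t i i'` as
  the incidence *matrix* between the enhanced states of two arbitrary homological degrees
  (`Matrix.toLin'` on the function spaces `degStates i → R`);
* the concrete homology `frobeniusHomology R h t i = ker dᵢ ⧸ (im dᵢ₋₁ ⊓ ker dᵢ)`, the honest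
  `CochainComplex` `frobeniusComplex R h t hd hG` for realisable diagrams (`hd` the `d² = 0` fact), and the comparison
  `nonempty_iso_frobeniusHomology_homology`;
* the bigraded integral theory at `h = t = 0`: `khovanovDQ`, `khovanovHomology G i j`
  (`Kh^{i,j}` of the diagram), invariance under the accepted `GaussDiagram.Equiv` for realisable
  diagrams, and the values on the empty diagram (unknot).

## Sources

* M. Khovanov, *A categorification of the Jones polynomial*, Duke Math. J. 101 (2000)
  359–426, §4 (cube), Prop. 8 (`d² = 0`), Thm. 1 (invariance).
* D. Bar-Natan, *On Khovanov's categorification of the Jones polynomial*, Algebr. Geom.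
  Topol. 2 (2002) 337–370, §3.2 (gradings, the unknot has generators in `q = ±1`), Thm. 2.
* O. Viro, *Khovanov homology, its definitions and ramifications*, Fund. Math. 184 (2004)
  317–342, §5 (enhanced states, §5.2 incidence numbers).
* M. Khovanov, *Link homology and Frobenius extensions*, Fund. Math. 190 (2006) 179–190,
  §2 and Prop. 4 (the universal system `X² = hX + t`).
* M. Goussarov, M. Polyak, O. Viro, *Finite-type invariants of classical and virtual knots*,
  Topology 39 (2000), Thm. 1.B (realisable diagrams related by moves present isotopic knots).
* V. O. Manturov, *Khovanov homology for virtual knots with arbitrary coefficients*,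
  Izv. Math. 71 (2007) 967–999 (for virtual diagrams the naive complex has `d² ≠ 0` over `ℤ`).
* Mathlib: no Khovanov homology, Frobenius algebra tables or enhanced states (searched
  `Khovanov`, `Frobenius`, `enhanced`); we use `Matrix.toLin'`, `Matrix.of`, `LinearMap.ker`,
  `LinearMap.range`, `Submodule.comap`, submodule quotients, `ModuleCat.of`,
  `CochainComplex.of`, `HomologicalComplex.homology`, `Module.finrank`.

## Design choices (review #1, option (b), cast-free)

* All *definitions* are total on `GaussDiagram` (which contains virtual diagrams) and rely on
  no sorried theorem. The differential is the incidence matrix between the enhanced states of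
  two *arbitrary* homological degrees `i`, `i'`, as `Matrix.toLin'` on function spaces
  `degStates i → R`; it is meaningful for `i' = i + 1` and zero otherwise
  (`khovanovD_eq_zero_of_ne`). Thus no casts along `i + 1 = j` or `-1 + 1 = 0` ever arise, and
  quotients of submodules of Pi types elaborate (quotients of submodules of `α →₀ R` do not
  elaborate at this Mathlib pin because of an instance-transparency diamond; hence functions,
  not `Finsupp`).
* Homology is the concrete subquotient `ker dᵢ ⧸ comap (ker dᵢ).subtype (range dᵢ₋₁)`, i.e.
  `ker dᵢ ⧸ (im dᵢ₋₁ ⊓ ker dᵢ)`, which is total and is the honest homology whenever `d² = 0`.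
* `d² = 0` (`khovanovD_comp_khovanovD`), the `CochainComplex` packaging `frobeniusComplex`
  and every invariance statement carry the realisability hypothesis
  `hG : ∃ K : Knot, K.HasGaussDiagram G`: for non-realisable (virtual) Gauss diagrams the
  naive complex (with the zero map on one-to-one bifurcations) does **not** square to zero
  over `ℤ` (Manturov (2007)); in the third case of the merge/split/neither trichotomy of
  `KhResolutions` the incidence number is set to `0` (Viro (2004), §5; this case is not
  reachable for realisable `G`, `isMergeAt_or_isSplitAt_of_hasGaussDiagram`).
* Labels live on arcs and are constant on state circles (`EnhancedState.label_eq`), so no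
  functions out of quotient types are needed; `Fintype`/`DecidableEq` are by injection into
  `State × (Arc → Bool)`.
* Grading conventions: Bar-Natan (2002), §3.2: `homDegree = weight - n₋`,
  `qDegree = #(circles labelled 1) - #(circles labelled X) + weight + n₊ - 2 n₋`; the unknot
  (empty diagram) has `Kh^{0,±1} = ℤ` and nothing else.
-/

open Function Set CategoryTheory

noncomputable section

namespace Literature.Topology.FourManifolds

namespace GaussDiagram

variable (G : GaussDiagram)

/-! ## The Frobenius system `R[X]/(X² - hX - t)` -/

section Ring

variable (R : Type) [CommRing R]

/-- The **multiplication table** of the Frobenius algebra `A = R[X]/(X² - hX - t)` on the basis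
`1 ↔ false`, `X ↔ true`: `mergeCoeff R h t a b c` is the coefficient of the basis vector `c` in
the product `a · b`. Table: `1·1 = 1`, `1·X = X·1 = X`, `X·X = hX + t`; i.e.
`(F,F,F) ↦ 1`, `(F,T,T) ↦ 1`, `(T,F,T) ↦ 1`, `(T,T,T) ↦ h`, `(T,T,F) ↦ t`, all others `0`.
Used on merge edges of the cube. Khovanov (2006), §2; Khovanov (2000), §2.1 (`h = t = 0`);
Bar-Natan (2002), §3.2. [cite: Khovanov2006] -/
def mergeCoeff (h t : R) : Bool → Bool → Bool → R
  | false, false, false => 1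
  | false, true, true => 1
  | true, false, true => 1
  | true, true, true => h
  | true, true, false => t
  | _, _, _ => 0

/-- The **comultiplication table** of the Frobenius algebra `A = R[X]/(X² - hX - t)` on the
basis `1 ↔ false`, `X ↔ true`: `splitCoeff R h t a b c` is the coefficient of `b ⊗ c` in
`Δ a`. Table: `Δ 1 = 1 ⊗ X + X ⊗ 1 - h · 1 ⊗ 1`, `Δ X = X ⊗ X + t · 1 ⊗ 1`; i.e.
`(F,F,T) ↦ 1`, `(F,T,F) ↦ 1`, `(F,F,F) ↦ -h`, `(T,T,T) ↦ 1`, `(T,F,F) ↦ t`, all others `0`.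
Used on split edges of the cube. Khovanov (2006), §2; Khovanov (2000), §2.1;
Bar-Natan (2002), §3.2. [cite: Khovanov2006] -/
def splitCoeff (h t : R) : Bool → Bool → Bool → R
  | false, false, true => 1
  | false, true, false => 1
  | false, false, false => -h
  | true, true, true => 1
  | true, false, false => t
  | _, _, _ => 0

end Ring

/-! ## Enhanced states and gradings -/

/-- An **enhanced state** of a Gauss diagram (Viro (2004), §5; Khovanov (2000), §4.2: a
generator of the cube complex): a state `state` (complete resolution) together with a
labelling of its state circles by the basis `{1 ↔ false, X ↔ true}` of the Frobenius algebra,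
recorded as a function `label` on arcs which is constant along state circles (`label_eq`:
equal on adjacent arcs of the state graph, hence on connected components). [cite: Viro2004] -/
structure EnhancedState where
  /-- The underlying state (complete resolution). -/
  state : G.State
  /-- The label `1 ↔ false`, `X ↔ true` of the state circle through each arc. -/
  label : G.Arc → Bool
  /-- Labels are constant along state circles. -/
  label_eq : ∀ a b, (G.stateGraph state).Adj a b → label a = label b

/-- Enhanced states form a finite type (injection into `State × (Arc → Bool)`).
Khovanov (2000), §4.2 (the cube complex is finitely generated). [cite: Khovanov2000] -/
instance EnhancedState.instFintype : Fintype G.EnhancedState :=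
  Fintype.ofInjective (fun s ↦ (s.state, s.label)) (fun s t h ↦ by
    cases s; cases t; simp only [Prod.mk.injEq] at h; obtain ⟨h1, h2⟩ := h; subst h1 h2; rfl)

/-- Equality of enhanced states is decidable (equality of the state and of the labelling). [folklore] -/
instance EnhancedState.instDecidableEq : DecidableEq G.EnhancedState := fun s t ↦
  decidable_of_iff (s.state = t.state ∧ s.label = t.label)
    ⟨fun h ↦ by cases s; cases t; simp only at h; obtain ⟨h1, h2⟩ := h; subst h1 h2; rfl,
     fun h ↦ by subst h; exact ⟨rfl, rfl⟩⟩

variable {G} in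
/-- The **homological degree** of an enhanced state: `i(s) = |s| - n₋` (weight of the state
minus the number of negative crossings). Bar-Natan (2002), §3.2; Rasmussen (2010), §2. [cite: BarNatan2002] -/
def homDegree (s : G.EnhancedState) : ℤ := (s.state.weight : ℤ) - G.nMinus

variable {G} in
/-- The **quantum degree** of an enhanced state:
`j(s) = #(circles labelled 1) - #(circles labelled X) + |s| + n₊ - 2 n₋` (a circle is
labelled `1`, resp. `X`, if some arc on it has label `false`, resp. `true`; by `label_eq`
exactly one of the two holds). With this normalisation the unknot has its two generators in
bidegrees `(0, ±1)`. Bar-Natan (2002), §3.2; Viro (2004), §5.1. [cite: BarNatan2002] -/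
def qDegree (s : G.EnhancedState) : ℤ :=
  ((Finset.univ.filter fun c : G.StateCircle s.state ↦
      ∃ a, G.circleOf s.state a = c ∧ s.label a = false).card : ℤ) -
  ((Finset.univ.filter fun c : G.StateCircle s.state ↦
      ∃ a, G.circleOf s.state a = c ∧ s.label a = true).card : ℤ) +
  s.state.weight + G.nPlus - 2 * G.nMinus

variable {G} in
/-- The **Koszul sign** of the edge `σ → σ[i ↦ 1]` of the cube of resolutions:
`(-1) ^ #{j < i | σ j = 1}`. Khovanov (2000), §3.3; Bar-Natan (2002), §3.2. [cite: Khovanov2000] -/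
def edgeSign (σ : G.State) (i : Fin G.n) : ℤ :=
  (-1) ^ (Finset.univ.filter fun j ↦ j < i ∧ σ j = true).card

/-! ## Incidence numbers and the differential -/

section Ring

variable (R : Type) [CommRing R]

/-- The **incidence number** `⟨d s, s'⟩ ∈ R` of two enhanced states in the Khovanov complex
over `A = R[X]/(X² - hX - t)` (Viro (2004), §5.2; Khovanov (2000), §4.2; Khovanov (2006), §2).
It is zero unless `s'.state` is obtained from `s.state` by flipping a single `0`-smoothing
`i` to `1` (`s'.state = Function.update s.state i true`; such an `i` is unique, and is
extracted by `Classical.choose`). In that case, with `a := arcIn (overPos i)` and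
`b := arcOut (overPos i)` the two local strands at chord `i`, there is a three-way case split
(`KhResolutions`):
* *merge* (`IsMergeAt`): the labels of `s` and `s'` must agree at every arc off the merged
  circle of `s'` (the circle of `a` in `s'.state`); the value is
  `edgeSign s.state i * mergeCoeff h t (s.label a) (s.label b) (s'.label a)`;
* *split* (`IsSplitAt`): the labels must agree at every arc off the split circle of `s` (the
  circle of `a` in `s.state`); the value is
  `edgeSign s.state i * splitCoeff h t (s.label a) (s'.label a) (s'.label b)`;
* *neither* (one-to-one bifurcation, only reachable for non-realisable, i.e. virtual, Gauss
  diagrams; Manturov (2007); Viro (2004), §5): the value is `0` by convention. [cite: Viro2004] -/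
def incidence (h t : R) (s s' : G.EnhancedState) : R :=
  if hi : ∃ i, s.state i = false ∧ s'.state = Function.update s.state i true then
    let i := Classical.choose hi
    let a := G.arcIn (G.overPos i)
    let b := G.arcOut (G.overPos i)
    if G.IsMergeAt s.state i then
      if ∀ c, G.circleOf s'.state c ≠ G.circleOf s'.state a → s'.label c = s.label c then
        (edgeSign s.state i : R) * mergeCoeff R h t (s.label a) (s.label b) (s'.label a)
      else 0
    else if G.IsSplitAt s.state i then
      if ∀ c, G.circleOf s.state c ≠ G.circleOf s.state a → s'.label c = s.label c then
        (edgeSign s.state i : R) * splitCoeff R h t (s.label a) (s'.label a) (s'.label b)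
      else 0
    else 0
  else 0

variable {G} in
/-- Flipping a `0`-smoothing to a `1`-smoothing raises the weight of a state by one.
Bar-Natan (2002), §3.1 (edges of the cube go up one level). [cite: BarNatan2002] -/
theorem State.weight_update {σ : G.State} {i : Fin G.n} (hi : σ i = false) :
    State.weight (Function.update σ i true) = σ.weight + 1 := by
  unfold State.weight
  have h : (Finset.univ.filter fun j ↦ Function.update σ i true j = true) =
      insert i (Finset.univ.filter fun j ↦ σ j = true) := by
    ext j
    by_cases hj : j = i
    · subst hj; simp
    · simp [hj]
  rw [h, Finset.card_insert_of_notMem (by simp [hi])]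

variable {G R} in
/-- A nonzero incidence number `⟨d s, s'⟩` raises the homological degree by one.
Bar-Natan (2002), §3.2. [cite: BarNatan2002] -/
theorem homDegree_eq_of_incidence_ne_zero {h t : R} {s s' : G.EnhancedState}
    (h0 : G.incidence R h t s s' ≠ 0) : homDegree s' = homDegree s + 1 := by
  unfold incidence at h0
  by_cases hi : ∃ i, s.state i = false ∧ s'.state = Function.update s.state i true
  · obtain ⟨i, hi0, hs'⟩ := hi
    simp only [homDegree, hs', State.weight_update hi0]
    push_cast
    ring
  · exact (h0 (by rw [dif_neg hi])).elim

/-- The enhanced states of homological degree `i` (a finite type with decidable equality):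
the basis of the `i`-th cochain group. Bar-Natan (2002), §3.2. [cite: BarNatan2002] -/
abbrev degStates (i : ℤ) : Type := {s : G.EnhancedState // homDegree s = i}

/-- The enhanced states of bidegree `(i, j)` (homological degree `i`, quantum degree `j`):
the basis of the bigraded cochain group `C^{i,j}`. Bar-Natan (2002), §3.2. [cite: BarNatan2002] -/
abbrev bidegStates (i j : ℤ) : Type := {s : G.EnhancedState // homDegree s = i ∧ qDegree s = j}

/-- The **Khovanov differential** over `A = R[X]/(X² - hX - t)` from homological degree `i` to
homological degree `i'`: the incidence matrix `(⟨d s, s'⟩)_{s', s}` (`incidence`) between the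
enhanced states of degrees `i` and `i'`, as a linear map (`Matrix.toLin'`) between the free
modules of functions `degStates i → R` and `degStates i' → R`. It is the differential of the
Khovanov complex for `i' = i + 1` and is zero otherwise (`khovanovD_eq_zero_of_ne`); taking
two arbitrary degrees avoids all index casts. Khovanov (2000), §4.2; Bar-Natan (2002), §3.2;
Viro (2004), §5.2; Khovanov (2006), §2. [cite: Khovanov2000] -/
def khovanovD (h t : R) (i i' : ℤ) : (G.degStates i → R) →ₗ[R] (G.degStates i' → R) :=
  Matrix.toLin' (Matrix.of fun (s' : G.degStates i') (s : G.degStates i) ↦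
    G.incidence R h t s.1 s'.1)

/-- The incidence matrix between degrees `i` and `i' ≠ i + 1` vanishes: a nonzero incidence
number `⟨d s, s'⟩` requires `s'.state = update s.state i true` with `s.state i = false`, so
that `|s'| = |s| + 1`. Bar-Natan (2002), §3.2. [cite: BarNatan2002] -/
theorem khovanovD_eq_zero_of_ne (h t : R) {i i' : ℤ} (hi : i' ≠ i + 1) :
    G.khovanovD R h t i i' = 0 := by
  have h0 : (Matrix.of fun (s' : G.degStates i') (s : G.degStates i) ↦
      G.incidence R h t s.1 s'.1) = 0 := by
    ext s' s
    by_contra hne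
    exact hi (by rw [← s'.2, ← s.2, homDegree_eq_of_incidence_ne_zero hne])
  rw [khovanovD, h0, map_zero]

/-- **`d² = 0` for realisable diagrams.** If the Gauss diagram `G` is realised by a knot, the
Khovanov differential squares to zero: every two-dimensional face of the cube of resolutions
commutes (functoriality of the Frobenius algebra TQFT on planar cobordisms) and the Koszul
signs `edgeSign` make it anticommute. Khovanov (2000), Prop. 8; Bar-Natan (2002), §3.2;
Khovanov (2006), Prop. 4 (general `(h, t)`). This is **false** without `hG` in general: for
non-realisable (virtual) Gauss diagrams with the zero map on one-to-one bifurcations, `d² ≠ 0`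
over `ℤ` (Manturov (2007)). [cite: Khovanov2000] -/
def khovanovD_comp_khovanovD : Prop :=
  ∀ (h t : R) (hG : ∃ K : Knot, K.HasGaussDiagram G) (i : ℤ),
    G.khovanovD R h t (i + 1) (i + 1 + 1) ∘ₗ G.khovanovD R h t i (i + 1) = 0

/-- The **homology** of the Khovanov complex over `A = R[X]/(X² - hX - t)` in homological
degree `i`, as the concrete subquotient `ker dᵢ ⧸ (im dᵢ₋₁ ⊓ ker dᵢ)` (the range of `dᵢ₋₁`
pulled back along the inclusion of `ker dᵢ`). This is total (defined for every Gauss diagram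
and every `(h, t)`) and is the honest homology whenever `d² = 0`, in particular for realisable
diagrams (`nonempty_iso_frobeniusHomology_homology`). For `(h, t) = (0, 0), (0, 1), (1, 0)`
over suitable `R` this is Khovanov, Lee, Bar-Natan homology of the diagram (unnormalised in
`q`). Khovanov (2000), §7; Khovanov (2006), §2; Bar-Natan (2002), §3.2. [cite: Khovanov2000] -/
def frobeniusHomology (h t : R) (i : ℤ) : ModuleCat R :=
  ModuleCat.of R
    (↥(LinearMap.ker (G.khovanovD R h t i (i + 1))) ⧸
      (LinearMap.range (G.khovanovD R h t (i - 1) i)).comap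
        (LinearMap.ker (G.khovanovD R h t i (i + 1))).subtype)

/-- The **Khovanov cochain complex** of a realisable Gauss diagram over
`A = R[X]/(X² - hX - t)`, as a `CochainComplex (ModuleCat R) ℤ` (`CochainComplex.of`): the
`i`-th group is the free module `degStates i → R` on the enhanced states of homological
degree `i`, the differential is `khovanovD R h t i (i + 1)`.
Relies on: the named fact `khovanovD_comp_khovanovD` (`d² = 0`, true under `hG`), taken as the
hypothesis `hd`.
Khovanov (2000), §4.2, §7; Bar-Natan (2002), §3.2; Khovanov (2006), §2. [cite: Khovanov2000, §7] -/
def frobeniusComplex (h t : R) (hd : G.khovanovD_comp_khovanovD R)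
    (hG : ∃ K : Knot, K.HasGaussDiagram G) : CochainComplex (ModuleCat R) ℤ :=
  CochainComplex.of (fun i ↦ ModuleCat.of R (G.degStates i → R))
    (fun i ↦ ModuleCat.ofHom (G.khovanovD R h t i (i + 1)))
    (fun i ↦ by rw [← ModuleCat.ofHom_comp, hd h t hG i]; rfl)

/-- The concrete homology `frobeniusHomology` agrees with the categorical homology
(`HomologicalComplex.homology`) of the cochain complex `frobeniusComplex` for realisable
diagrams (Mathlib's `ModuleCat` homology API identifies the latter with
`ker dᵢ ⧸ im dᵢ₋₁`, and `im dᵢ₋₁ ≤ ker dᵢ` by `khovanovD_comp_khovanovD`).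
Khovanov (2000), §7. [cite: Khovanov2000] -/
def nonempty_iso_frobeniusHomology_homology : Prop :=
  ∀ (h t : R) (hd : G.khovanovD_comp_khovanovD R) (hG : ∃ K : Knot, K.HasGaussDiagram G) (i : ℤ),
    Nonempty (G.frobeniusHomology R h t i ≅ (G.frobeniusComplex R h t hd hG).homology i)

end Ring

/-! ## Bigraded integral Khovanov homology (`h = t = 0`) -/

variable {G} in
/-- At `h = t = 0` the differential preserves the quantum degree: a nonzero integral incidence
number `⟨d s, s'⟩` forces `qDegree s' = qDegree s` (`m` and `Δ` are homogeneous of degree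
`-1` for the grading `deg 1 = 1`, `deg X = -1`, compensated by the shift `+|s|`).
Khovanov (2000), §4.3; Bar-Natan (2002), §3.2. [cite: Khovanov2000] -/
def qDegree_eq_of_incidence_ne_zero : Prop :=
  ∀ {s s' : G.EnhancedState} (h0 : G.incidence ℤ 0 0 s s' ≠ 0),
    qDegree s' = qDegree s

/-- The **bigraded integral Khovanov differential** `d : C^{i,j} → C^{i',j}` (`h = t = 0`):
the integral incidence matrix between the enhanced states of bidegrees `(i, j)` and `(i', j)`
(meaningful for `i' = i + 1`; the differential preserves `j`,
`qDegree_eq_of_incidence_ne_zero`). Khovanov (2000), §4.3; Bar-Natan (2002), §3.2. [cite: Khovanov2000] -/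
def khovanovDQ (i i' j : ℤ) : (G.bidegStates i j → ℤ) →ₗ[ℤ] (G.bidegStates i' j → ℤ) :=
  Matrix.toLin' (Matrix.of fun (s' : G.bidegStates i' j) (s : G.bidegStates i j) ↦
    G.incidence ℤ 0 0 s.1 s'.1)

/-- The **Khovanov homology** `Kh^{i,j}(G)` of a Gauss diagram in bidegree `(i, j)`
(homological degree `i`, quantum degree `j`), over `ℤ`, as the concrete subquotient
`ker d ⧸ (im d ⊓ ker d)` of the bigraded integral complex at `h = t = 0`. Total; it is the
Khovanov homology of the knot for realisable diagrams (`nonempty_iso_khovanovHomology_of_equiv`).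
Khovanov (2000), §7, Thm. 1; Bar-Natan (2002), §3.2. [cite: Khovanov2000] -/
def khovanovHomology (i j : ℤ) : ModuleCat ℤ :=
  ModuleCat.of ℤ
    (↥(LinearMap.ker (G.khovanovDQ i (i + 1) j)) ⧸
      (LinearMap.range (G.khovanovDQ (i - 1) i j)).comap
        (LinearMap.ker (G.khovanovDQ i (i + 1) j)).subtype)

/-- **Invariance of Khovanov homology.** Two *realisable* Gauss diagrams related by Polyak's
Reidemeister moves (accepted `GaussDiagram.Equiv`) have isomorphic Khovanov homology in every
bidegree: realisable diagrams related by moves present isotopic knots (Goussarov–Polyak–Viro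
(2000), Thm. 1.B; accepted `Knot.reidemeister`), and Khovanov homology is a knot invariant
(Khovanov (2000), Thm. 1; Bar-Natan (2002), Thm. 2). Both realisability hypotheses are
needed since intermediate diagrams of a chain of Polyak moves may be virtual. [cite: Khovanov2000] -/
def nonempty_iso_khovanovHomology_of_equiv : Prop :=
  ∀ {G G' : GaussDiagram} (hG : ∃ K : Knot, K.HasGaussDiagram G) (hG' : ∃ K : Knot, K.HasGaussDiagram G') (e : G.Equiv G') (i j : ℤ),
    Nonempty (G.khovanovHomology i j ≅ G'.khovanovHomology i j)

/-- The Khovanov homology of the empty diagram (the round unknot) vanishes outside the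
bidegrees `(0, 1)` and `(0, -1)`. Khovanov (2000), §6.1; Bar-Natan (2002), §3.2. [cite: Khovanov2000] -/
def isZero_khovanovHomology_empty : Prop :=
  ∀ (i j : ℤ) (hij : (i, j) ≠ (0, 1) ∧ (i, j) ≠ (0, -1)),
    Limits.IsZero (GaussDiagram.empty.khovanovHomology i j)

/-- The Khovanov homology of the empty diagram (the round unknot) in bidegree `(0, 1)` is
free of rank one (generated by the single circle labelled `1`). Khovanov (2000), §6.1;
Bar-Natan (2002), §3.2. [cite: Khovanov2000] -/
def finrank_khovanovHomology_empty_zero_one : Prop :=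
  Module.finrank ℤ (GaussDiagram.empty.khovanovHomology 0 1) = 1

/-- The Khovanov homology of the empty diagram (the round unknot) in bidegree `(0, -1)` is
free of rank one (generated by the single circle labelled `X`). Khovanov (2000), §6.1;
Bar-Natan (2002), §3.2. [cite: Khovanov2000] -/
def finrank_khovanovHomology_empty_zero_neg_one : Prop :=
  Module.finrank ℤ (GaussDiagram.empty.khovanovHomology 0 (-1)) = 1

end GaussDiagram

end Literature.Topology.FourManifolds
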